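import Literature.Computability.QuantumComplexity.UniversalExecutorInput
import Literature.Computability.QuantumComplexity.CWrapAssembly
import Literature.Computability.QuantumComplexity.CoinFamilyKernel
import Literature.Computability.Complexity.PlumbingBricks
import HarnessLib

/-!
# Search problems solved by polynomial-time generated Clifford+`T` circuits are in `FBQP`

Topic `Literature/Computability/QuantumComplexity`; the search-problem companion of
`OneCleanQubitProofs.mem_BQP_of_generated_circuits` (languages decided by polynomial-time generated
circuits are in `BQP`). In the tree's model a bounded-error quantum SEARCH algorithm is a
polynomial-time uniform family with ONE circuit per input length, run on `|x⟩|0…0⟩` and measured on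
all wires (`Cryptography.IsQSolvable`); an algorithm whose circuit is written by a classical computer
from the input `x` itself ("a classical computer … outputs a description of the circuit",
Nielsen–Chuang 2010, §4.5; the `P`-uniform families printed with counters of Arora–Barak 2009, §6.2)
is brought to that form by the universal executor `UExec.family` (`UniversalExecutor.lean`) fed with
the gate table of the circuit (`UExec.tableOfL`, `UniversalExecutorInput.lean`) and wrapped classically
(`isQSolvable_classicalWrap_holds`, Bernstein–Vazirani 1997, §8). This file proves:

* **`UExec.kernelProb_family_of_rows`**, **`UExec.kernelProb_family_tableOfL_readR`** — the ALL-WIRES output law of the executor (the kernel-level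
  form of `UExec.acceptProbOn_family_tableOfL`): on the table of an oracle-free gate list `gs` on
  `t = tOf ℓ` wires (`|gs| ≤ t`), the measured string is, with the Born weights of `gs` run on `|0^t⟩`,
  the table with the simulated register written on the wires `0, ℓ+1, …, ℓ+t-1`
  (`Function.extend (UExec.R ℓ)`);
* `UExec.readR ℓ k y = y[0] · y[ℓ+1 … ℓ+k-1]` reads the first `k` simulated wires off that string
  (`readR_ofFn_extend`);
* `isQSolvable_classicalWrap_dep` — the classical wrap with a relation depending on the original
  input `x` and not only on `h x` (the proof of `CWrap.kernelProb_family_ge` is pointwise in `x`);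
* **`isQSolvable_of_generated_circuits`**: if `x ↦ (1^{k x}, rawGates (C x))` is computed on codes in
  polynomial time, every `C x` is an oracle-free Clifford+`T` circuit on `k x ≥ 1` wires, `post ∈ FP`,
  the relation `Rel` is closed under extension of the output, and `C x` run on `|0…0⟩` and measured
  yields with probability `≥ 2/3` a register content `f` with `post ⟨x, f⟩ ∈ Rel x`, then
  `IsQSolvable Rel`.

Everything is proved; no named fact is introduced.

## References

* M. A. Nielsen, I. L. Chuang, *Quantum Computation and Quantum Information*, CUP 2010, §4.5
  (the circuit model; uniform families) and §2.2.5, §2.2.8 (Born rule; one register of a product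
  state) [NielsenChuang2010].
* S. Arora, B. Barak, *Computational Complexity: A Modern Approach*, CUP 2009, §6.2 (`P`-uniform
  circuit families), §10.3 [AroraBarak2009].
* E. Bernstein, U. Vazirani, *Quantum complexity theory*, SIAM J. Comput. 26 (1997), §8
  [BernsteinVazirani1997].
* S. Aaronson, *BQP and the polynomial hierarchy*, STOC 2010, §1 (FBQP) [Aaronson2010].
-/

noncomputable section

namespace Literature.Computability.QuantumComplexity

open _root_.Computability Complexity Cryptography Matrix

namespace UExec

variable {ℓ : ℕ}

/-! ### The all-wires output law of the executor -/

/-- **The output state of the executor** on a table describing the oracle-free gate list `gs`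
(the state-level content of `acceptProb_circ`): the table wires keep their values, the simulated
register `R ℓ` carries `gs` run on `|0…0⟩`, the work wire is clean. [cite: NielsenChuang2010, §4.3 and §4.5] -/
theorem runOn_circ (hF : Fits ℓ) (gs : List (QGate cliffordT (tOf ℓ)))
    (hlen : gs.length ≤ tOf ℓ) (hfree : ∀ γ ∈ gs, γ.IsOracleFree) (T : QReg ℓ)
    (hrows : ∀ s : Fin (tOf ℓ), RowIs hF s (padInput T (anc ℓ)) gs[(s : ℕ)]?)
    (h0 : T ⟨0, pos_of_fits hF⟩ = false) :
    (circ ℓ).runOn 0 (basisState (padInput T (anc ℓ))) =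
      restBlockState (R ℓ) ((⟨gs⟩ : QCircuit cliffordT (tOf ℓ)).toMatrix 0 *ᵥ basisState (fun _ => false))
        (padInput T (anc ℓ)) := by
  have hfree' : ∀ (s : Fin (tOf ℓ)) γ, gs[(s : ℕ)]? = some γ → γ.IsOracleFree := fun s γ hγ =>
    hfree γ (List.mem_of_getElem? hγ)
  rw [QCircuit.runOn, circ, dif_pos hF, basisState_eq_restBlockState (R ℓ) (padInput T (anc ℓ)),
    padInput_comp_R hF T h0, allOps,
    flatMap_slotOps_mulVec_restBlockState hF (padInput_aW T) (fun s => gs[(s : ℕ)]?) hfree' hrows,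
    foldl_optApply_getElem? gs hlen]

/-- Restricting an extension along the simulated register gives back the register content. [folklore] -/
theorem extend_comp_R (f : QReg (tOf ℓ)) (c : QReg (ℓ + anc ℓ)) : Function.extend (R ℓ) f c ∘ R ℓ = f :=
  funext fun i => (R ℓ).injective.extend_apply f c i

/-- **The all-wires output law of the executor on a table** (list form): for `Fits ℓ` and an
oracle-free gate list `gs` on `tOf ℓ` wires with `|gs| ≤ tOf ℓ` described by the rows of `T`
(`|T| = ℓ`, leading bit `0`), the probability that the measured string lies in `E` is the Born mass,
under `gs` run on `|0…0⟩`, of the register contents `f` whose embedding into the padded table —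
`f` written on the wires `R ℓ` — reads in `E`. [cite: NielsenChuang2010, §2.2.5 and §4.5] -/
theorem kernelProb_family_of_rows (T : List Bool) (hF : Fits T.length) (gs : List (QGate cliffordT (tOf T.length)))
    (hlen : gs.length ≤ tOf T.length) (hfree : ∀ γ ∈ gs, γ.IsOracleFree)
    (hrows : ∀ (s : Fin (tOf T.length)) (δ : Cand (tOf T.length)),
      T.getD (cw T.length s δ.col) false = true ↔ gs[(s : ℕ)]? = some δ.toGate)
    (h0 : T.getD 0 false = false) (E : Set (List Bool)) [DecidablePred (· ∈ E)] :
    family.kernelProb 0 T E =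
      ∑ f : QReg (tOf T.length),
        if List.ofFn (Function.extend (R T.length) f (padInput T.get (anc T.length))) ∈ E then
          ‖((⟨gs⟩ : QCircuit cliffordT (tOf T.length)).toMatrix 0 *ᵥ basisState (fun _ => false)) f‖ ^ 2
        else 0 := by
  classical
  have hget : ∀ (v : ℕ) (hv : v < T.length), padInput T.get (anc T.length) ⟨v, by omega⟩ = T.getD v false := by
    intro v hv
    rw [show (⟨v, by omega⟩ : Fin (T.length + anc T.length)) = Fin.castAdd (anc T.length) ⟨v, hv⟩ from rfl,
      padInput, Fin.append_left, List.getD_eq_getElem _ _ hv, List.get_eq_getElem]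
  have hrows' : ∀ s : Fin (tOf T.length), RowIs hF s (padInput T.get (anc T.length)) gs[(s : ℕ)]? := by
    intro s δ
    rw [← hrows s δ, ← hget _ (cw_lt hF s.isLt δ.col_lt)]; rfl
  have h0' : T.get ⟨0, pos_of_fits hF⟩ = false := by
    rw [List.getD_eq_getElem _ _ (pos_of_fits hF)] at h0
    rw [List.get_eq_getElem]; exact h0
  rw [QCircuitFamily.kernelProb, QCircuitFamily.kernel, toReal_outputPMF_map_ofFn]
  change ∑ z : QReg (T.length + anc T.length),
    (if List.ofFn z ∈ E then ‖(circ T.length).runOn 0 (basisState (padInput T.get (anc T.length))) z‖ ^ 2 else 0) = _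
  rw [runOn_circ hF gs hlen hfree T.get hrows' h0']
  set c := padInput T.get (anc T.length) with hc
  set ψ := (⟨gs⟩ : QCircuit cliffordT (tOf T.length)).toMatrix 0 *ᵥ basisState (fun _ => false) with hψ
  have hterm : ∀ z : QReg (T.length + anc T.length),
      (if List.ofFn z ∈ E then ‖restBlockState (R T.length) ψ c z‖ ^ 2 else 0) =
      if AgreeOff (R T.length) z c then (if List.ofFn z ∈ E then ‖ψ (z ∘ R T.length)‖ ^ 2 else 0) else 0 := by
    intro z
    rw [restBlockState_apply]
    by_cases ha : AgreeOff (R T.length) z c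
    · rw [if_pos ha, if_pos ha]
    · rw [if_neg ha, if_neg ha]; simp
  simp_rw [hterm]
  rw [sum_ite_agreeOff_eq_sum_extend]
  refine Finset.sum_congr rfl fun f _ => ?_
  rw [extend_comp_R]

/-! ### Reading the simulated register off the measured string -/

/-- `readR ℓ k y`: bit `0` of `y` followed by the bits `ℓ+1, …, ℓ+k-1` — the first `k` simulated
wires of the executor (`val_R`). [folklore] -/
def readR (ℓ k : ℕ) (y : List Bool) : List Bool := y.take 1 ++ (y.drop (ℓ + 1)).take (k - 1)

/-- **`readR` recovers the register**: on the measured string of the executor — the padded table with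
`f` written on the wires `R ℓ` — `readR ℓ k` returns the first `k ≤ tOf ℓ` bits of `f` (`k ≥ 1`).
[folklore] -/
theorem readR_ofFn_extend {k : ℕ} (hk : 1 ≤ k) (hkt : k ≤ tOf ℓ) (f : QReg (tOf ℓ)) (c : QReg (ℓ + anc ℓ)) :
    readR ℓ k (List.ofFn (Function.extend (R ℓ) f c)) = List.ofFn (f ∘ Fin.castLEEmb hkt) := by
  have ht : 0 < tOf ℓ := by omega
  have hanc : anc ℓ = tOf ℓ + 1 := rfl
  set z := Function.extend (R ℓ) f c with hz
  have hzR : ∀ i : Fin (tOf ℓ), z (R ℓ i) = f i := fun i => (R ℓ).injective.extend_apply f c i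
  have hlen1 : ((List.ofFn z).take 1).length = 1 := by
    rw [List.length_take, List.length_ofFn, hanc]; omega
  have hlen2 : (((List.ofFn z).drop (ℓ + 1)).take (k - 1)).length = k - 1 := by
    rw [List.length_take, List.length_drop, List.length_ofFn, hanc]; omega
  apply List.ext_getElem
  · rw [readR, List.length_append, hlen1, hlen2, List.length_ofFn]; omega
  · intro i h1 h2
    rw [List.length_ofFn] at h2
    rw [List.getElem_ofFn]
    unfold readR
    by_cases hi : i = 0
    · subst hi
      rw [List.getElem_append_left (by rw [hlen1]; omega), List.getElem_take, List.getElem_ofFn]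
      have hR0 : R ℓ ⟨0, ht⟩ = ⟨0, by rw [hanc]; omega⟩ := Fin.ext (by rw [val_R, if_pos rfl])
      have h := hzR ⟨0, ht⟩
      rw [hR0] at h
      exact h
    · rw [List.getElem_append_right (by rw [hlen1]; omega), List.getElem_take, List.getElem_drop,
        List.getElem_ofFn]
      have hRi : R ℓ ⟨i, by omega⟩ = ⟨ℓ + 1 + (i - ((List.ofFn z).take 1).length), by rw [hlen1, hanc]; omega⟩ :=
        Fin.ext (by rw [val_R, if_neg hi]; dsimp only; rw [hlen1]; omega)
      have h := hzR ⟨i, by omega⟩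
      rw [hRi] at h
      exact h

/-- **The all-wires output law of the executor on the table of a gate list, read through `readR`.**
For `Fits ℓ`, an oracle-free gate list `gs` on `tOf ℓ` wires with `|gs| ≤ tOf ℓ` and `1 ≤ k ≤ tOf ℓ`: the
probability that `readR ℓ k` of the measured string satisfies `P` is the Born mass, under `gs` run on
`|0…0⟩`, of the register contents whose first `k` bits satisfy `P`.
[cite: NielsenChuang2010, §2.2.5 and §4.5 (the quantum circuit model)] -/
theorem kernelProb_family_tableOfL_readR (hF : Fits ℓ) (gs : List (QGate cliffordT (tOf ℓ)))
    (hlen : gs.length ≤ tOf ℓ) (hfree : ∀ γ ∈ gs, γ.IsOracleFree) {k : ℕ} (hk : 1 ≤ k) (hkt : k ≤ tOf ℓ)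
    (P : List Bool → Prop) [DecidablePred P] :
    family.kernelProb 0 (tableOfL ℓ (gs.map QGate.toRaw)) {y | P (readR ℓ k y)} =
      ∑ f : QReg (tOf ℓ), if P (List.ofFn (f ∘ Fin.castLEEmb hkt)) then
        ‖((⟨gs⟩ : QCircuit cliffordT (tOf ℓ)).toMatrix 0 *ᵥ basisState (fun _ => false)) f‖ ^ 2 else 0 := by
  classical
  -- transport along `|tableOfL ℓ raws| = ℓ`
  suffices key : ∀ (T : List Bool), T.length = ℓ →
      (∀ (s : Fin (tOf ℓ)) (δ : Cand (tOf ℓ)), T.getD (cw ℓ s δ.col) false = true ↔ gs[(s : ℕ)]? = some δ.toGate) →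
      T.getD 0 false = false →
      family.kernelProb 0 T {y | P (readR ℓ k y)} =
        ∑ f : QReg (tOf ℓ), if P (List.ofFn (f ∘ Fin.castLEEmb hkt)) then
          ‖((⟨gs⟩ : QCircuit cliffordT (tOf ℓ)).toMatrix 0 *ᵥ basisState (fun _ => false)) f‖ ^ 2 else 0 from
    key _ (length_tableOfL hF _) (getD_tableOfL_iff gs) (getD_tableOfL_zero ℓ _)
  rintro T rfl hrows h0
  rw [kernelProb_family_of_rows T hF gs hlen hfree hrows h0]
  refine Finset.sum_congr rfl fun f _ => ?_
  simp only [Set.mem_setOf_eq, readR_ofFn_extend hk hkt]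

end UExec

/-! ### The classical wrap with an input-dependent relation -/

/-- **Classical pre- and post-processing inside quantum search, input-dependent form.** As
`isQSolvable_classicalWrap_holds`, but the event asked of the inner family on `h x` may depend on the
original input `x` (not only on `h x`): if `h, g ∈ FP`, `F` is a uniform oracle-free Clifford+`T`
family and `F` on input `h x` lands in `S x` with probability `≥ 2/3` for every `x`, then
"`x ↦` a string with prefix `g ⟨x, y⟩`, `y ∈ S x`" is `IsQSolvable` (the kernel bound
`CWrap.kernelProb_family_ge` is pointwise in `x`, so it applies to the constant relation `fun _ => S x`).
[cite: BernsteinVazirani1997, §8 (classical computation inside quantum machines)] -/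
theorem isQSolvable_classicalWrap_dep (h g : List Bool → List Bool) (hh : h ∈ FP) (hg : g ∈ FP)
    {F : QCircuitFamily cliffordT} (hFfree : F.IsOracleFree) (hU : F.IsUniform)
    (S : List Bool → Set (List Bool)) (hF : ∀ x, 2 / 3 ≤ F.kernelProb 0 (h x) (S x)) :
    IsQSolvable fun x => {z | ∃ y ∈ S x, g (boolPair x y) <+: z} := by
  obtain ⟨P, rfl, rfl, rfl⟩ := CWrap.exists_params hh hg hU
  exact ⟨CWrap.family P, CWrap.family_isOracleFree P hFfree, CWrap.family_isUniform P hU,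
    fun x => (hF x).trans (CWrap.kernelProb_family_ge P x (fun _ => S x))⟩

/-! ### Generated circuits solve search problems -/

section Generated

open Complexity.CodeFP UExec

/-- The register width of the executor run for a circuit on `k` wires with `m` gates: `3 + k + m`
(so that `Fits (t⁴)`, `k ≤ t` and `m ≤ t`). [folklore] -/
def genT (k m : ℕ) : ℕ := 3 + k + m

/-- **The table of a generated circuit**: the executor table of length `t⁴`, `t = 3 + k + |raws|`, of
the raw gate list (read on the first `k` of `t` wires). [cite: NielsenChuang2010, §4.5 (uniform families: a classical computer outputs a description of the circuit)] -/
def genTable (k : ℕ) (raws : List RawGate) : List Bool :=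
  tableOfL (genT k raws.length ^ 4) raws

/-- The generated table is computed in polynomial time from `(1ᵏ, raws)`. [cite: AroraBarak2009, §1.3, §6.2] -/
theorem genTable_fp : CodeFP tcE strE (fun c => genTable c.1 c.2) := by
  have hk : CodeFP tcE unE (fun c => c.1) := fst _ _
  have hraws : CodeFP tcE (rawE RawGate.E) (fun c => c.2) := snd _ _
  have ht : CodeFP tcE unE (fun c => 3 + c.1 + c.2.length) :=
    (unAdd.comp ((unAdd.comp ((const _ 3).pair hk)).pair ((ulength _).comp hraws)) :)
  have hℓ0 : CodeFP tcE unE (fun c => ((3 + c.1 + c.2.length) * (3 + c.1 + c.2.length)) *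
      ((3 + c.1 + c.2.length) * (3 + c.1 + c.2.length))) := (unSq.comp (unSq.comp ht) :)
  have hℓ : CodeFP tcE unE (fun c => (3 + c.1 + c.2.length) ^ 4) := hℓ0.congr fun c => by ring
  exact ((tableOfL_fp.comp (hℓ.pair hraws)).congr fun c => rfl :)

/-- Unary numerals of the read-out parameters, in polynomial time from `(1ᵏ, raws)`:
`1^{t⁴ + 1}` (how many wires to drop) and `1^{k-1}` (how many to keep after the first). [folklore] -/
theorem genDrop_fp : CodeFP tcE unE (fun c => genT c.1 c.2.length ^ 4 + 1) := by
  have hk : CodeFP tcE unE (fun c => c.1) := fst _ _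
  have hraws : CodeFP tcE (rawE RawGate.E) (fun c => c.2) := snd _ _
  have ht : CodeFP tcE unE (fun c => 3 + c.1 + c.2.length) :=
    (unAdd.comp ((unAdd.comp ((const _ 3).pair hk)).pair ((ulength _).comp hraws)) :)
  have hℓ0 : CodeFP tcE unE (fun c => ((3 + c.1 + c.2.length) * (3 + c.1 + c.2.length)) *
      ((3 + c.1 + c.2.length) * (3 + c.1 + c.2.length))) := (unSq.comp (unSq.comp ht) :)
  have hℓ : CodeFP tcE unE (fun c => genT c.1 c.2.length ^ 4) := hℓ0.congr fun c => by unfold genT; ring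
  exact (unSucc.comp hℓ :)

/-- `1^{k-1}` from `(1ᵏ, raws)` (`min (k - 1) k` through the binary numeral). [folklore] -/
theorem genKeep_fp : CodeFP tcE unE (fun c => c.1 - 1) := by
  have hk : CodeFP tcE unE (fun c => c.1) := fst _ _
  have hsub : CodeFP tcE natE (fun c => c.1 - 1) := (natSub.comp ((natOfUn.comp hk).pair (const _ 1)) :)
  exact (unOfNatMin.comp (hk.pair hsub)).congr fun c => by simp

variable {Rel : List Bool → Set (List Bool)} {k : List Bool → ℕ}

/-- **Search problems solved by polynomial-time generated circuits are `IsQSolvable`.** Let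
`C x` be an oracle-free Clifford+`T` circuit on `k x ≥ 1` wires whose description `(1^{k x}, rawGates (C x))`
is computed from `x` in polynomial time, `post ∈ FP` a classical post-processor and `Rel` a relation closed
under extension of the output string. If for every `x` the circuit `C x`, run on `|0…0⟩` and measured on
all wires, yields with probability `≥ 2/3` a content `f` with `post ⟨x, f⟩ ∈ Rel x`, then `IsQSolvable Rel`:
write the table of `C x` (`genTable`, `h ∈ FP`), run the universal executor on it (uniform,
oracle-free; all-wires law `UExec.kernelProb_family_tableOfL`), read the simulated register off the
measured string and post-process (`g ∈ FP`), by `isQSolvable_classicalWrap_dep`.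
[cite: NielsenChuang2010, §4.5 (the quantum circuit model; uniform circuit families)]
[cite: BernsteinVazirani1997, §8 (classical computation inside quantum machines)] -/
theorem isQSolvable_of_generated_circuits
    (hR : ∀ x y z, y ∈ Rel x → y <+: z → z ∈ Rel x)
    (C : (x : List Bool) → QCircuit cliffordT (k x)) (hfree : ∀ x, (C x).IsOracleFree) (hk : ∀ x, 1 ≤ k x)
    (hgen : CodeFP strE tcE fun x => (k x, (C x).rawGates))
    (post : List Bool → List Bool) (hpost : post ∈ FP)
    (hprob : ∀ x, 2 / 3 ≤ (C x).probEvent 0 (basisState fun _ => false)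
      {f | post (boolPair x (List.ofFn f)) ∈ Rel x}) :
    IsQSolvable Rel := by
  classical
  -- the pre-processor
  set h : List Bool → List Bool := fun x => genTable (k x) (C x).rawGates with hh_def
  have hh : h ∈ FP := by
    obtain ⟨F, hF, hFh⟩ := genTable_fp.comp hgen
    have : F = h := funext fun x => by simpa using hFh x
    rw [← this]; exact hF
  -- the read-out parameters as string functions
  obtain ⟨Dr, hDr, hDr_eq⟩ := genDrop_fp.comp hgen
  obtain ⟨Kp, hKp, hKp_eq⟩ := genKeep_fp.comp hgen
  have hDr' : ∀ x, Dr x = unE (genT (k x) (C x).rawGates.length ^ 4 + 1) := fun x => by simpa using hDr_eq x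
  have hKp' : ∀ x, Kp x = unE (k x - 1) := fun x => by simpa using hKp_eq x
  -- the post-processor: read the register, pair it with `x`, apply `post`
  set rd : List Bool → List Bool := OracleCompose.concatFn ∘ fanoutFn
      (Plumb.takeFn ∘ fanoutFn (fun _ => unE 1) Brick.sndF)
      (Plumb.takeFn ∘ fanoutFn (Kp ∘ Brick.fstF) (Plumb.dropFn ∘ fanoutFn (Dr ∘ Brick.fstF) Brick.sndF)) with hrd_def
  have hrd : rd ∈ FP :=
    comp_mem_FP OracleCompose.concatFn_mem_FP (fanoutFn_mem_FP
      (comp_mem_FP Plumb.takeFn_mem_FP (fanoutFn_mem_FP (const_mem_FP _) Brick.sndF_mem_FP))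
      (comp_mem_FP Plumb.takeFn_mem_FP (fanoutFn_mem_FP (comp_mem_FP hKp Brick.fstF_mem_FP)
        (comp_mem_FP Plumb.dropFn_mem_FP (fanoutFn_mem_FP (comp_mem_FP hDr Brick.fstF_mem_FP) Brick.sndF_mem_FP)))))
  have hrd_apply : ∀ x y, rd (boolPair x y) = readR (genT (k x) (C x).rawGates.length ^ 4) (k x) y := by
    intro x y
    simp only [hrd_def, Function.comp_apply, fanoutFn_apply, Brick.fstF_boolPair, Brick.sndF_boolPair,
      OracleCompose.concatFn_boolPair, Plumb.takeFn_boolPair, Plumb.dropFn_boolPair, hDr', hKp', unE_eq_ones,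
      ones, List.length_replicate, readR]
  set g : List Bool → List Bool := post ∘ fanoutFn Brick.fstF rd with hg_def
  have hg : g ∈ FP := comp_mem_FP hpost (fanoutFn_mem_FP Brick.fstF_mem_FP hrd)
  have hg_apply : ∀ x y, g (boolPair x y) =
      post (boolPair x (readR (genT (k x) (C x).rawGates.length ^ 4) (k x) y)) := by
    intro x y
    simp only [hg_def, Function.comp_apply, fanoutFn_apply, Brick.fstF_boolPair, hrd_apply]
  -- the wrapped executor
  set S : List Bool → Set (List Bool) := fun x => {y | g (boolPair x y) ∈ Rel x} with hS
  have hsolv := isQSolvable_classicalWrap_dep h g hh hg family_isOracleFree family_isUniform S ?_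
  · refine hsolv.mono fun x z => ?_
    rintro ⟨y, hy, hyz⟩
    exact hR x _ _ hy hyz
  -- the executor on the table of `C x` lands in `S x` with the probability of the good register contents
  intro x
  set t := genT (k x) (C x).rawGates.length with ht_def
  have htO : tOf (t ^ 4) = t := tOf_pow_four t
  have hF : Fits (t ^ 4) := by unfold Fits; rw [htO]; exact one_add_mul_rowW_le_pow_four (by unfold genT at ht_def; omega)
  have hkt : k x ≤ tOf (t ^ 4) := by rw [htO, ht_def]; unfold genT; omega
  set gs : List (QGate cliffordT (tOf (t ^ 4))) := (mapWires (Fin.castLEEmb hkt) (C x)).gates with hgs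
  have hraw : gs.map QGate.toRaw = (C x).rawGates := by
    rw [hgs, ← QCircuit.rawGates, rawGates_mapWires_castLE]
  have hlen : gs.length ≤ tOf (t ^ 4) := by
    rw [hgs, gates_mapWires, List.length_map, htO, ht_def, genT, ← QCircuit.size, ← QCircuit.length_rawGates]
    omega
  have hfree' : ∀ γ ∈ gs, γ.IsOracleFree := isOracleFree_mapWires _ (hfree x)
  have hhx : h x = tableOfL (t ^ 4) (gs.map QGate.toRaw) := by rw [hraw]; rfl
  have hSx : S x = {y | post (boolPair x (readR (t ^ 4) (k x) y)) ∈ Rel x} := by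
    ext y; simp only [hS, Set.mem_setOf_eq, hg_apply, ht_def]
  rw [hhx, hSx, kernelProb_family_tableOfL_readR hF gs hlen hfree' (hk x) hkt
    (fun w => post (boolPair x w) ∈ Rel x)]
  -- and the state is `C x |0…0⟩` on the first `k x` wires
  have hstate : (⟨gs⟩ : QCircuit cliffordT (tOf (t ^ 4))).toMatrix 0 *ᵥ basisState (fun _ => false) =
      placeGate (Fin.castLEEmb hkt) ((C x).toMatrix 0) *ᵥ basisState (fun _ => false) := by
    rw [show (⟨gs⟩ : QCircuit cliffordT (tOf (t ^ 4))) = mapWires (Fin.castLEEmb hkt) (C x) from rfl,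
      toMatrix_mapWires]
  rw [hstate, sum_normSq_placeGate_castLE hkt ((C x).toMatrix 0) (fun _ => false)
    (fun u => post (boolPair x (List.ofFn u)) ∈ Rel x)]
  refine (hprob x).trans (le_of_eq ?_)
  rw [QCircuit.probEvent, Finset.sum_filter]
  refine Finset.sum_congr rfl fun u _ => ?_
  simp only [Set.mem_setOf_eq, QCircuit.runOn, mulVec_basisState]
  rfl

end Generated

end Literature.Computability.QuantumComplexity
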